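import Summits.AtomisticToContinuum.Crystallization.Theorems.ChartedZeroExcessLayeredLatticeLiouvilleF

/-!
# ChartedZeroExcessLayered · LatticeLiouville — part G/8: §E «FlatnessHalving» (decomp-a2c lens-2 generation 25 = v9; NEW content, not in v8 4defadc6…):
the lens «structural dichotomy (special vs generic)» applied to g24's declared residual P♭ `LinearisedFlatnessLayered` — SPECIAL = asymptotically
EXACTLY flat root windows (decided: the exact endgame Z is PROVED for every `Λ ≤ 4`), GENERIC = persistent misfit (excluded by E «FlatnessExtinction»,
which is PROVED from the ONE-STEP ε-regularity H «FlatnessHalving» by iteration down the scales); net ★ `linearisedFlatnessLayered_of_halving :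
FlatnessHalving Λ θ κ → LinearisedFlatnessLayered Λ θ κ` (`Λ ≤ 4`, `0 < κ`) and the v9 columns `gap_and_pert_1_50_of_certs_16h` / `_layered_pieces_16h` /
`_certs_16H`.  ONE namespace `…Theorems.ChartedZeroExcessLayeredLatticeLiouville` across the parts, linear import chain (imports part F).

P♭ `LinearisedFlatnessLayered Λ θ κ` bundles three things (its docstring, part F): the nonlinear ε-regularity AT ONE SCALE RATIO, its ITERATION down the
scales fed by R's uniform κ, and the EXACT ENDGAME «misfit → 0 on every root window ⇒ exactly layered ⇒ `TwoPeriodic Λ`».  Here: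
* SPECIAL class `AsymptoticallyLayerFlat Λ S` — beyond some radius every root window is ε-flat for EVERY ε > 0 (misfit EXTINGUISHES along the scales).
  The target restricted to the special class is PURELY STRUCTURAL and PROVED for every `Λ ≤ 4` (= the environment radius): ★ `exactEndgame_of_le`
  — the WINDOWED form of lens-3's tree exactness-by-discreteness `twoPeriodic_of_forall_nearHomBD` (…DoorLayeredExactness; global chart, sup
  currency): per-WINDOW charts depending on (ε, R), the L² → sup passage at a finite window (`nearHomBD_of_nearHomL2BD`, cost `√(ε·#window)`),
  Bolzano–Weierstrass on the generator images with the chart co-bound carrying independence to the limit (tree `add_mem_of_near_translates`,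
  `norm_le_norm_symm_mul`), and — the new step — a PIGEONHOLE on the finitely many ROOT NEIGHBOURS of length `≤ Λ` as the window radius runs
  through `ℕ`, gluing per-window translates into two global exact periods (rooted + separated suffice: no energy, no equations, no cleanliness).
* GENERIC class (some root windows of unbounded radius keep misfit `≥ ε₀ > 0`) — EMPTY among κ-flat θ-good door sets: E «FlatnessExtinction» = P♭
  with its conclusion weakened from `TwoPeriodic Λ S` to `AsymptoticallyLayerFlat Λ S`; ★ E ⟸ H PROVED (`flatnessExtinction_of_halving`: induction
  on the dyadic level `κ/2^k` along the windows `M^j R`, then Archimedes).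
* H «FlatnessHalving Λ θ κ» = the ONE-STEP nonlinear ε-regularity (DECLARED RESIDUAL of g25): GIVEN both linear certificates, for every δ there are a
  scale ratio `M ≥ 1` and a discrete floor `R₀ > 0` such that on every θ-good door set, at EVERY level `0 < η ≤ κ` and every radius `R ≥ R₀`,
  `flat(η) on B(0, M·R) ⇒ flat(η/2) on B(0, R)`.  EXHAUSTION = classical (special ∨ generic).
Net: **P♭ ⟸ H ALONE modulo theorems** — g24's declared residual «ε-regularity + iteration + endgame» SHRINKS to the one-step lemma.  H is STRONGER
than P♭ (a RATE statement; P♭ is silent unless all windows are flat) — a TRANSFER, admissible because it is EASIER in the precise sense that its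
proof is ONE compactness-and-linearisation argument at a single scale ratio (Schoen–Uhlenbeck / Evans–Gariepy excess-decay shape; discretely: the
Campanato iteration's inductive step), and TRUE-type for the reason P♭ is (exactly layered clean door sets are 0-flat at every radius).
WHY NOVEL (tree-relative, presearch 2026-08-31): `lean search 'FlatnessHalving|AsymptoticallyLayerFlat|ExactEndgame|FlatnessExtinction'` → no hits;
the tree's exactness theorem is global (`twoPeriodic_of_forall_nearHomBD`), its excess-decay objects (`ExcessDecayLiouville*`, hcp, bounded
DISPLACEMENT) have no windowed-L² halving statement; corpus/galaxy: excess-decay iteration is continuum (harmonic maps / minimal surfaces / elliptic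
systems: giaquinta1984, Evans–Gariepy), discrete ε-regularity for point configurations — no hits (queries in the NODE card).
-/

noncomputable section

open scoped BigOperators InnerProductSpace RealInnerProductSpace
open MeasureTheory Set Metric Filter Topology
open Summit.AtomisticToContinuum.Crystallization.Theorems.ChartedPlanarOrderRigidityDoor (E3 IsClean IsNash IsCharted VisibleGap PertRegime atomsIn)
open Summit.AtomisticToContinuum.Crystallization.Theorems.ChartedPlanarOrderDensityDichotomy (μS IsSep nK nK_nonneg)
open Summit.AtomisticToContinuum.Crystallization.Theorems.ChartedPlanarOrderMesoCut (IsDoorSet NearHom LayeredHom EnvClose)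
open Summit.AtomisticToContinuum.Crystallization.Theorems.OverbindingBudgetLiouvilleDictionary (NearHomBD nearHom_of_nearHomBD)
open Summit.AtomisticToContinuum.Crystallization.Theorems.ChartedPlanarOrderDoorLayered
  (TwoPeriodic not_twoPeriodic_singleton DoorHomogeneityBD DoorPeriodic PeriodicBulkGapDoor PeriodicBulkGap
   doorPeriodic_of_doorHomogeneityBD gap_and_pert_1_50_of_periodic gap_and_pert_1_50_of_periodic'
   NearHomL2BD CleanScaleCoherenceL2BD FlatnessExactL2BD doorPeriodic_of_L2 cleanScaleCoherenceL2BD_of_large nearHomL2BD_mono Layered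
   IsPeriod IsPeriod.neg isPeriod_layered_fst isPeriod_layered_snd layeredHom_eq_layered linearIndependent_triangularVec
   norm_map_triangularVec_le norm_le_norm_symm_mul layeredHom_add_gen₁ layeredHom_add_gen₂ exists_atom_near_gen
   nearHomBD_of_nearHomL2BD nearHomBD_mono_tol add_mem_of_near_translates not_nearHomL2BD_singleton)
open Summit.AtomisticToContinuum.Crystallization.Theorems.ChartedPlanarOrderDoorLayeredOsc
  (IsTwoShellAffineGood OscillationImprovement DoorPeriodicOsc doorPeriodic_of_osc doorPeriodicOsc_of_doorPeriodic
   oscillationImprovement_of_ge mem_iff_μS_singleton_ne_zero)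
open Literature.MathematicalPhysics.StatisticalMechanics (triangularVec₁ triangularVec₂)

namespace Summit.AtomisticToContinuum.Crystallization.Theorems.ChartedZeroExcessLayeredLatticeLiouville

/-! ## §E  «FlatnessHalving» (generation 25) — the statements -/

/-- **«AsymptoticallyLayerFlat Λ S»** — the SPECIAL class of the lens: beyond some radius `R₀` (uniform in ε) every root window of `S` is `ε`-flat
in mean square at environment radius 4 for EVERY `ε > 0`, under layered charts of distortion `≤ Λ` (chart re-chosen per window and per ε) — the misfit
EXTINGUISHES along the scales.  Non-vacuous: `not_asymptoticallyLayerFlat_singleton`. [this file, v9] -/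
def AsymptoticallyLayerFlat (Λ : ℝ) (S : Set E3) : Prop :=
  ∃ R₀ : ℝ, ∀ ε : ℝ, 0 < ε → ∀ R : ℝ, R₀ ≤ R → NearHomL2BD Λ ε 4 S (atomsIn (μS S) 0 R)

/-- **Z(Λ) «ExactEndgame»** — the target ON THE SPECIAL CLASS: a rooted separated asymptotically layer-flat set is EXACTLY two-periodic with periods
`≤ Λ`.  PROVED for `Λ ≤ 4` (`exactEndgame_of_le`); kept as a named Prop so that the node's seam `P♭ ⟸ E ∧ Z` is visible. [this file, v9] -/
def ExactEndgame (Λ : ℝ) : Prop :=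
  ∀ δ : ℝ, 0 < δ → ∀ S : Set E3, (0 : E3) ∈ S → IsSep δ S → AsymptoticallyLayerFlat Λ S → TwoPeriodic Λ S

/-- **H(Λ, θ, κ) «FlatnessHalving»** — the ONE-STEP nonlinear ε-regularity (DECLARED RESIDUAL of g25): GIVEN both linear Liouville certificates, for
every separation δ there are a scale ratio `M ≥ 1` and a discrete floor `R₀ > 0` such that for every θ-good door set, EVERY level `0 < η ≤ κ` and every
radius `R ≥ R₀`: mean-square layered misfit `≤ η` on the root window of radius `M·R` ⇒ `≤ η/2` on the root window of radius `R` (charts re-chosen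
per window, as in `NearHomL2BD`; same Λ and environment radius on both sides; factor 1/2 at fixed M — any `c < 1` is equivalent by iterating M).
Mechanism of record = P's: linearise the Nash equations at the big window's own layered chart; a sequence of windows violating the halving blows up
(`R → ∞`) to a bounded-gradient `layeredKernel`-harmonic (resp. `ljKernel`-harmonic) field on a clean STABLE structure, affine-with-free-layer-constants by the
certificates = tangent to the chart family ⇒ the linear misfit improves by `C/M²`; the nonlinear remainder is `O(√η)`-relatively small for `η ≤ κ`
inside the basin; `M` is chosen once with `C/M² ≤ 1/4`.  ANTI-monotone in θ and in κ (`FlatnessHalving.anti_anti`).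
Why it might fail: (a) the DISCRETE FLOOR — at bounded `R` no blow-up is available and the halving is a direct perturbative estimate needing the
discrete interior (Campanato) estimate for the linearised layered operator (true for constant-coefficient lattice systems; here infinite-range
kernels of `LJDecay`/`LayeredDecay` class); (b) REFERENCE DEFECT — `NearHomL2BD`'s reference `LayeredHom L w` has FREE per-layer offsets and an
arbitrary distortion-≤Λ chart, so it need not be an equilibrium: the linearisation carries a source term unless near-optimal charts at small η are
automatically `O(√η)`-close to clean NASH windows (expected from the two-sided matching; if not, flatness is to be measured against Nash layered
references — a re-typing of the currency, not of the split); (c) the BASIN `κ ≤ κ₀`.  Cheapest falsifier: census TAG 163 KORN-R II (which IS a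
one-step contraction measurement) returning a contraction factor `≥ 1/2` per factor-`M` rescale at rms environment misfit `1/8`, or a factor that
does NOT become level-independent as `η ↓ 0`.  Sources: excess-decay-by-blow-up (Schoen–Uhlenbeck 1982; Evans–Gariepy; giaquinta1984 ch. III),
cite-level. [this file, v9] -/
def FlatnessHalving (Λ θ κ : ℝ) : Prop :=
  LatticeLiouvilleCert → LayeredLiouvilleCert → ∀ δ : ℝ, 0 < δ → ∃ M : ℝ, 1 ≤ M ∧ ∃ R₀ : ℝ, 0 < R₀ ∧
    ∀ S : Set E3, IsDoorSet δ S → (∀ q ∈ S, IsTwoShellAffineGood θ S q) →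
      ∀ η : ℝ, 0 < η → η ≤ κ → ∀ R : ℝ, R₀ ≤ R →
        NearHomL2BD Λ η 4 S (atomsIn (μS S) 0 (M * R)) → NearHomL2BD Λ (η / 2) 4 S (atomsIn (μS S) 0 R)

/-- **E(Λ, θ, κ) «FlatnessExtinction»** — the GENERIC class is EMPTY: given both certificates, a θ-good door set all of whose root windows are κ-flat is
asymptotically layer-flat.  = P♭ with its conclusion WEAKENED from `TwoPeriodic Λ S` to `AsymptoticallyLayerFlat Λ S`; E ⟹ P♭ through Z
(`linearisedFlatnessLayered_of_extinction`, `Λ ≤ 4`); ⟸ H PROVED (`flatnessExtinction_of_halving`).  UNDECIDED · TRUE-type · EQUIVALENT to P♭ in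
substance (the endgame being a theorem; the converse P♭ ⟹ E is structural, not typed: given periods may be an ill-conditioned chart). [this file, v9] -/
def FlatnessExtinction (Λ θ κ : ℝ) : Prop :=
  LatticeLiouvilleCert → LayeredLiouvilleCert → ∀ δ : ℝ, 0 < δ → ∀ S : Set E3, IsDoorSet δ S → (∀ q ∈ S, IsTwoShellAffineGood θ S q) →
    (∀ R : ℝ, 0 < R → NearHomL2BD Λ κ 4 S (atomsIn (μS S) 0 R)) → AsymptoticallyLayerFlat Λ S

/-! ### Z proved: asymptotically exactly flat, rooted, separated sets are two-periodic (`Λ ≤ 4`) -/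

/-- the root window of a separated set is finite. [folklore] -/
theorem finite_atomsIn {δ : ℝ} (hδ : 0 < δ) {S : Set E3} (hS : IsSep δ S) (R : ℝ) : (atomsIn (μS S) 0 R).Finite := by
  have hf : (closedBall (0 : E3) R ∩ S).Finite :=
    Literature.Probability.Process.LocalConfig.finite_inter_of_separated hδ hS (isCompact_closedBall (0 : E3) R)
  exact hf.subset fun p hp => ⟨mem_closedBall.2 hp.2, (mem_iff_μS_singleton_ne_zero S p).1 hp.1⟩

/-- membership in the root window: `p ∈ S` and `‖p‖ ≤ R`. [folklore] -/
theorem mem_atomsIn_iff {S : Set E3} {p : E3} {R : ℝ} : p ∈ atomsIn (μS S) 0 R ↔ p ∈ S ∧ ‖p‖ ≤ R := by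
  rw [← dist_zero_right p]
  exact ⟨fun h => ⟨(mem_iff_μS_singleton_ne_zero S p).1 h.1, h.2⟩, fun h => ⟨(mem_iff_μS_singleton_ne_zero S p).2 h.1, h.2⟩⟩

/-- **Step A — one window, one tolerance** (the WINDOWED form of the tree's `exists_near_periods_of_nearHomBD`, same proof with `Q` in place of `S`):
from ONE near-homogeneity instance of a window `Q` (radius `≥ Λ`), approximate periods `a = L t₁`, `b = L t₂` of length `≤ Λ`, quantitatively
independent (`‖s t₁ + t t₂‖ ≤ Λ‖s a + t b‖`), each of `±a, ±b` `τ`-matched by atoms of `S` at every point of `Q`. -/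
theorem exists_near_periods_of_nearHomBD_window {Λ τ r : ℝ} (hΛr : Λ ≤ r) {S Q : Set E3} (h : NearHomBD Λ τ r S Q) :
    ∃ a b : E3, ‖a‖ ≤ Λ ∧ ‖b‖ ≤ Λ ∧
      (∀ s t : ℝ, ‖s • triangularVec₁ 1 + t • triangularVec₂ 1‖ ≤ Λ * ‖s • a + t • b‖) ∧
      ∀ x ∈ Q, (∃ p ∈ S, ‖p - x - a‖ ≤ τ) ∧ (∃ p ∈ S, ‖p - x + a‖ ≤ τ) ∧
        (∃ p ∈ S, ‖p - x - b‖ ≤ τ) ∧ (∃ p ∈ S, ‖p - x + b‖ ≤ τ) := by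
  obtain ⟨L, hL, hL', w, Ψ, -, hmaps, henv⟩ := h
  have hn := norm_map_triangularVec_le (L : E3 →L[ℝ] E3) hL
  refine ⟨(L : E3 →L[ℝ] E3) (triangularVec₁ 1), (L : E3 →L[ℝ] E3) (triangularVec₂ 1), hn.1, hn.2, fun s t => ?_,
    fun x hx => ?_⟩
  · have h1 := norm_le_norm_symm_mul L (s • triangularVec₁ 1 + t • triangularVec₂ 1)
    rw [map_add, map_smul, map_smul] at h1
    exact h1.trans (mul_le_mul_of_nonneg_right hL' (norm_nonneg _))
  · have hy : Ψ x ∈ LayeredHom (L : E3 →L[ℝ] E3) w := hmaps hx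
    have hyL : Ψ x ∈ Layered ((L : E3 →L[ℝ] E3) (triangularVec₁ 1)) ((L : E3 →L[ℝ] E3) (triangularVec₂ 1)) w := by
      rw [← layeredHom_eq_layered]; exact hy
    have hx' := henv x hx
    have hm₁ : Ψ x + (L : E3 →L[ℝ] E3) (-triangularVec₁ 1) ∈ LayeredHom (L : E3 →L[ℝ] E3) w := by
      rw [map_neg, layeredHom_eq_layered]
      exact ((isPeriod_layered_fst _ _ w).neg (Ψ x)).2 hyL
    have hm₂ : Ψ x + (L : E3 →L[ℝ] E3) (-triangularVec₂ 1) ∈ LayeredHom (L : E3 →L[ℝ] E3) w := by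
      rw [map_neg, layeredHom_eq_layered]
      exact ((isPeriod_layered_snd _ _ w).neg (Ψ x)).2 hyL
    refine ⟨?_, ?_, ?_, ?_⟩
    · exact exists_atom_near_gen hx' (layeredHom_add_gen₁ hy) (hn.1.trans hΛr)
    · obtain ⟨p, hp, hd⟩ := exists_atom_near_gen hx' hm₁ (by rw [map_neg, norm_neg]; exact hn.1.trans hΛr)
      exact ⟨p, hp, by rwa [map_neg, sub_neg_eq_add] at hd⟩
    · exact exists_atom_near_gen hx' (layeredHom_add_gen₂ hy) (hn.2.trans hΛr)
    · obtain ⟨p, hp, hd⟩ := exists_atom_near_gen hx' hm₂ (by rw [map_neg, norm_neg]; exact hn.2.trans hΛr)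
      exact ⟨p, hp, by rwa [map_neg, sub_neg_eq_add] at hd⟩

/-- **Step B — one window, all tolerances** (the WINDOWED form of the tree's `twoPeriodic_of_forall_nearHomBD` up to its last line): if a window `Q` of
a separated `S` is `(Λ; τ, r)`-near-homogeneous for EVERY `τ > 0` (`r ≥ Λ`, chart depending on τ) then there are linearly independent `a, b` of length
`≤ Λ` with `x ± a, x ± b ∈ S` for every `x ∈ Q` (Bolzano–Weierstrass on the generator images; discreteness = tree `add_mem_of_near_translates`). -/
theorem exact_translates_of_forall_nearHomBD_window {Λ δ r : ℝ} (hΛr : Λ ≤ r) (hδ : 0 < δ) {S : Set E3} (hS : IsSep δ S) {Q : Set E3}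
    (h : ∀ τ : ℝ, 0 < τ → NearHomBD Λ τ r S Q) :
    ∃ a b : E3, LinearIndependent ℝ ![a, b] ∧ ‖a‖ ≤ Λ ∧ ‖b‖ ≤ Λ ∧
      ∀ x ∈ Q, x + a ∈ S ∧ x + -a ∈ S ∧ x + b ∈ S ∧ x + -b ∈ S := by
  have hstep : ∀ n : ℕ, ∃ ab : E3 × E3, (‖ab.1‖ ≤ Λ ∧ ‖ab.2‖ ≤ Λ) ∧
      (∀ s t : ℝ, ‖s • triangularVec₁ 1 + t • triangularVec₂ 1‖ ≤ Λ * ‖s • ab.1 + t • ab.2‖) ∧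
      ∀ x ∈ Q, (∃ p ∈ S, ‖p - x - ab.1‖ ≤ 1 / ((n : ℝ) + 1)) ∧ (∃ p ∈ S, ‖p - x + ab.1‖ ≤ 1 / ((n : ℝ) + 1)) ∧
        (∃ p ∈ S, ‖p - x - ab.2‖ ≤ 1 / ((n : ℝ) + 1)) ∧ (∃ p ∈ S, ‖p - x + ab.2‖ ≤ 1 / ((n : ℝ) + 1)) := fun n => by
    obtain ⟨a, b, ha, hb, hq, hP⟩ := exists_near_periods_of_nearHomBD_window hΛr (h _ Nat.one_div_pos_of_nat)
    exact ⟨(a, b), ⟨ha, hb⟩, hq, hP⟩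
  choose ab hnorm hquant hper using hstep
  have hK : IsCompact (Metric.closedBall (0 : E3) Λ ×ˢ Metric.closedBall (0 : E3) Λ) :=
    (isCompact_closedBall 0 Λ).prod (isCompact_closedBall 0 Λ)
  have hmem : ∀ n, ab n ∈ Metric.closedBall (0 : E3) Λ ×ˢ Metric.closedBall (0 : E3) Λ := fun n =>
    ⟨mem_closedBall_zero_iff.2 (hnorm n).1, mem_closedBall_zero_iff.2 (hnorm n).2⟩
  obtain ⟨⟨a, b⟩, hab, φ, hφ, hlim⟩ := hK.tendsto_subseq hmem
  have ha : Tendsto (fun n => (ab (φ n)).1) atTop (𝓝 a) := (continuous_fst.tendsto _).comp hlim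
  have hb : Tendsto (fun n => (ab (φ n)).2) atTop (𝓝 b) := (continuous_snd.tendsto _).comp hlim
  have hε : Tendsto (fun n => 1 / ((φ n : ℝ) + 1)) atTop (𝓝 0) :=
    tendsto_one_div_add_atTop_nhds_zero_nat.comp hφ.tendsto_atTop
  have hpa : ∀ x ∈ Q, x + a ∈ S := fun x hx =>
    add_mem_of_near_translates hδ hS ha hε (fun n => (hper (φ n) x hx).1)
  have hna : ∀ x ∈ Q, x + -a ∈ S := fun x hx =>
    add_mem_of_near_translates hδ hS ha.neg hε (fun n => by simpa only [sub_neg_eq_add] using (hper (φ n) x hx).2.1)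
  have hpb : ∀ x ∈ Q, x + b ∈ S := fun x hx =>
    add_mem_of_near_translates hδ hS hb hε (fun n => (hper (φ n) x hx).2.2.1)
  have hnb : ∀ x ∈ Q, x + -b ∈ S := fun x hx =>
    add_mem_of_near_translates hδ hS hb.neg hε (fun n => by simpa only [sub_neg_eq_add] using (hper (φ n) x hx).2.2.2)
  have hq : ∀ s t : ℝ, ‖s • triangularVec₁ 1 + t • triangularVec₂ 1‖ ≤ Λ * ‖s • a + t • b‖ := fun s t => by
    have hc : Tendsto (fun n => Λ * ‖s • (ab (φ n)).1 + t • (ab (φ n)).2‖) atTop (𝓝 (Λ * ‖s • a + t • b‖)) :=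
      ((ha.const_smul s).add (hb.const_smul t)).norm.const_mul Λ
    exact ge_of_tendsto' hc (fun n => hquant (φ n) s t)
  refine ⟨a, b, ?_, mem_closedBall_zero_iff.1 hab.1, mem_closedBall_zero_iff.1 hab.2,
    fun x hx => ⟨hpa x hx, hna x hx, hpb x hx, hnb x hx⟩⟩
  rw [LinearIndependent.pair_iff]
  intro s t hst
  have h0 : ‖s • triangularVec₁ 1 + t • triangularVec₂ 1‖ ≤ 0 := by
    have h1 := hq s t
    rw [hst, norm_zero, mul_zero] at h1
    exact h1
  exact LinearIndependent.pair_iff.1 linearIndependent_triangularVec s t (norm_le_zero_iff.1 h0)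

/-- **Step B in the L² currency**: a FINITE window `Q` that is `(Λ, ε, 4)`-flat in mean square for EVERY `ε > 0` (`Λ ≤ 4`) has exact translates
`x ± a, x ± b ∈ S` for all `x ∈ Q` (mean square ⇒ sup at cost `√(ε·#Q)`, tree `nearHomBD_of_nearHomL2BD`; tolerance `τ` from `ε = τ²/(#Q + 1)`). -/
theorem exact_translates_of_forall_nearHomL2BD {Λ δ : ℝ} (hΛ : Λ ≤ 4) (hδ : 0 < δ) {S : Set E3} (hS : IsSep δ S) {Q : Set E3} (hQ : Q.Finite)
    (h : ∀ ε : ℝ, 0 < ε → NearHomL2BD Λ ε 4 S Q) :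
    ∃ a b : E3, LinearIndependent ℝ ![a, b] ∧ ‖a‖ ≤ Λ ∧ ‖b‖ ≤ Λ ∧
      ∀ x ∈ Q, x + a ∈ S ∧ x + -a ∈ S ∧ x + b ∈ S ∧ x + -b ∈ S := by
  refine exact_translates_of_forall_nearHomBD_window hΛ hδ hS fun τ hτ => ?_
  have hnK : 0 ≤ nK Q := nK_nonneg Q
  have hε : 0 < τ ^ 2 / (nK Q + 1) := by positivity
  refine nearHomBD_mono_tol ?_ (nearHomBD_of_nearHomL2BD hQ (h _ hε))
  calc Real.sqrt (τ ^ 2 / (nK Q + 1) * nK Q) ≤ Real.sqrt (τ ^ 2) := by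
        refine Real.sqrt_le_sqrt ?_
        rw [div_mul_eq_mul_div]
        exact div_le_of_le_mul₀ (by positivity) (by positivity) (by nlinarith [sq_nonneg τ])
    _ = τ := Real.sqrt_sq hτ.le

/-- ★★ **Z PROVED — `ExactEndgame Λ` for every `Λ ≤ 4`**: the target ON THE SPECIAL CLASS of the lens.  Step B on the growing root windows of radius
`max R₀ 0 + n`; the ROOT's own translates are root neighbours of length `≤ Λ` — finitely many candidates — so one pair `(a, b)` serves infinitely many
radii (pigeonhole), hence every point: `a, b` are exact periods of `S`. -/
theorem exactEndgame_of_le {Λ : ℝ} (hΛ : Λ ≤ 4) : ExactEndgame Λ := by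
  intro δ hδ S h0 hS hflat
  obtain ⟨R₀, hflat⟩ := hflat
  set R₁ : ℝ := max R₀ 0 with hR₁
  have hR₁0 : 0 ≤ R₁ := le_max_right _ _
  -- Step B on the window of radius `R₁ + n`
  have hB : ∀ n : ℕ, ∃ a b : E3, LinearIndependent ℝ ![a, b] ∧ ‖a‖ ≤ Λ ∧ ‖b‖ ≤ Λ ∧
      ∀ x ∈ atomsIn (μS S) 0 (R₁ + n), x + a ∈ S ∧ x + -a ∈ S ∧ x + b ∈ S ∧ x + -b ∈ S := fun n =>
    exact_translates_of_forall_nearHomL2BD hΛ hδ hS (finite_atomsIn hδ hS _) fun ε hε =>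
      hflat ε hε _ ((le_max_left _ _).trans (le_add_of_nonneg_right n.cast_nonneg))
  choose a b hli hna hnb hmem using hB
  -- the root's translates are root NEIGHBOURS of length ≤ Λ: finitely many candidates
  have h0mem : ∀ n : ℕ, (0 : E3) ∈ atomsIn (μS S) 0 (R₁ + n) := fun n =>
    mem_atomsIn_iff.2 ⟨h0, by rw [norm_zero]; positivity⟩
  set F : Set E3 := closedBall (0 : E3) Λ ∩ S with hF
  have hFfin : F.Finite := Literature.Probability.Process.LocalConfig.finite_inter_of_separated hδ hS (isCompact_closedBall 0 Λ)
  have haF : ∀ n, a n ∈ F := fun n => ⟨mem_closedBall_zero_iff.2 (hna n), by simpa using (hmem n 0 (h0mem n)).1⟩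
  have hbF : ∀ n, b n ∈ F := fun n => ⟨mem_closedBall_zero_iff.2 (hnb n), by simpa using (hmem n 0 (h0mem n)).2.2.1⟩
  haveI : Finite F := hFfin.to_subtype
  obtain ⟨⟨⟨a₀, ha₀⟩, ⟨b₀, hb₀⟩⟩, hinf⟩ := Finite.exists_infinite_fiber (fun n : ℕ => ((⟨a n, haF n⟩ : F), (⟨b n, hbF n⟩ : F)))
  have hinf' : ((fun n : ℕ => ((⟨a n, haF n⟩ : F), (⟨b n, hbF n⟩ : F))) ⁻¹' {(⟨a₀, ha₀⟩, ⟨b₀, hb₀⟩)}).Infinite :=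
    Set.infinite_coe_iff.1 hinf
  -- in the fibre `a n = a₀`, `b n = b₀`; the fibre is unbounded
  have fib : ∀ N : ℕ, ∃ n : ℕ, N < n ∧ a n = a₀ ∧ b n = b₀ := fun N => by
    obtain ⟨n, hn, hNn⟩ := hinf'.exists_gt N
    simp only [mem_preimage, mem_singleton_iff, Prod.mk.injEq, Subtype.mk.injEq] at hn
    exact ⟨n, hNn, hn.1, hn.2⟩
  -- any point of norm `< n` lies in the window of radius `R₁ + n`
  have win : ∀ (p : E3) (n : ℕ), p ∈ S → ‖p‖ < n → p ∈ atomsIn (μS S) 0 (R₁ + n) := fun p n hp hpn =>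
    mem_atomsIn_iff.2 ⟨hp, hpn.le.trans (le_add_of_nonneg_left hR₁0)⟩
  have period : ∀ v : E3, (∀ n, a n = a₀ ∧ b n = b₀ → ∀ x ∈ atomsIn (μS S) 0 (R₁ + n), x + v ∈ S ∧ x + -v ∈ S) →
      IsPeriod S v := by
    intro v hv p
    constructor
    · intro hp
      obtain ⟨N, hN⟩ := exists_nat_gt ‖p + v‖
      obtain ⟨n, hNn, han, hbn⟩ := fib N
      have := (hv n ⟨han, hbn⟩ (p + v) (win (p + v) n hp (hN.trans (by exact_mod_cast hNn)))).2
      rwa [add_neg_cancel_right] at this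
    · intro hp
      obtain ⟨N, hN⟩ := exists_nat_gt ‖p‖
      obtain ⟨n, hNn, han, hbn⟩ := fib N
      exact (hv n ⟨han, hbn⟩ p (win p n hp (hN.trans (by exact_mod_cast hNn)))).1
  obtain ⟨n₀, _, han₀, hbn₀⟩ := fib 0
  refine ⟨a₀, b₀, ?_, ?_, ?_, period a₀ ?_, period b₀ ?_⟩
  · simpa [han₀, hbn₀] using hli n₀
  · simpa [han₀] using hna n₀
  · simpa [hbn₀] using hnb n₀
  · rintro n ⟨han, hbn⟩ x hx
    exact ⟨han ▸ (hmem n x hx).1, han ▸ (hmem n x hx).2.1⟩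
  · rintro n ⟨han, hbn⟩ x hx
    exact ⟨hbn ▸ (hmem n x hx).2.2.1, hbn ▸ (hmem n x hx).2.2.2⟩

/-- the conclusion ON THE SPECIAL CLASS for door sets at the registration distortion `Λ = 2` (door sets are rooted and separated). -/
theorem twoPeriodic_of_asymptoticallyLayerFlat_two {δ : ℝ} (hδ : 0 < δ) {S : Set E3} (hS : IsDoorSet δ S)
    (h : AsymptoticallyLayerFlat 2 S) : TwoPeriodic 2 S :=
  exactEndgame_of_le (by norm_num) δ hδ S hS.1 hS.2.1 h

/-- **non-vacuity of the special class**: an isolated atom is NOT asymptotically layer-flat at `Λ = 2` (its root windows are `{0}`; tree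
`not_nearHomL2BD_singleton` with `Λ² ε = 4·(1/8) < 1`). -/
theorem not_asymptoticallyLayerFlat_singleton : ¬ AsymptoticallyLayerFlat 2 ({0} : Set E3) := by
  rintro ⟨R₀, h⟩
  have hw : atomsIn (μS ({0} : Set E3)) 0 (max R₀ 0) = {0} := by
    ext p
    rw [mem_atomsIn_iff, mem_singleton_iff]
    constructor
    · exact fun hp => hp.1
    · rintro rfl; exact ⟨rfl, by rw [norm_zero]; exact le_max_right _ _⟩
  have h1 := h (1 / 8) (by norm_num) (max R₀ 0) (le_max_left _ _)
  rw [hw] at h1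
  exact not_nearHomL2BD_singleton (by norm_num) (by norm_num) (by norm_num) (0 : E3) h1

/-! ### E ⟸ H (iteration down the scales, PROVED), the seam P♭ ⟸ E ∧ Z, and P♭ ⟸ H -/

/-- ★ **E ⟸ H** — ITERATION DOWN THE SCALES (PROVED): misfit `≤ κ/2^k` on every root window of radius `≥ R₀` by induction on `k` (the step from the
window of radius `M·R ≥ R₀`), then Archimedes (`κ/2^k < ε`). -/
theorem flatnessExtinction_of_halving {Λ θ κ : ℝ} (hκ : 0 < κ) (hH : FlatnessHalving Λ θ κ) : FlatnessExtinction Λ θ κ := by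
  intro hP hL δ hδ S hS hO hflat
  obtain ⟨M, hM, R₀, hR₀, hstep⟩ := hH hP hL δ hδ
  have iter : ∀ k : ℕ, ∀ R : ℝ, R₀ ≤ R → NearHomL2BD Λ (κ / 2 ^ k) 4 S (atomsIn (μS S) 0 R) := by
    intro k
    induction k with
    | zero => intro R hR; simpa using hflat R (hR₀.trans_le hR)
    | succ k ih =>
      intro R hR
      have hMR : R₀ ≤ M * R := hR.trans (le_mul_of_one_le_left (hR₀.le.trans hR) hM)
      have h1 := hstep S hS hO (κ / 2 ^ k) (by positivity)
        (div_le_self hκ.le (one_le_pow₀ (by norm_num))) R hR (ih (M * R) hMR)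
      rwa [pow_succ, ← div_div]
  refine ⟨R₀, fun ε hε R hR => ?_⟩
  obtain ⟨k, hk⟩ := exists_pow_lt_of_lt_one (div_pos hε hκ) (by norm_num : (1 / 2 : ℝ) < 1)
  refine nearHomL2BD_mono ?_ (iter k R hR)
  rw [div_eq_mul_inv, ← inv_pow, show ((2:ℝ)⁻¹) = 1 / 2 by norm_num]
  have := (lt_div_iff₀ hκ).1 hk
  linarith [this]

/-- ★ **THE SEAM: P♭ ⟸ E ∧ Z** (PROVED; door sets are rooted `hS.1` and separated `hS.2.1`). -/
theorem linearisedFlatnessLayered_of_extinction_endgame {Λ θ κ : ℝ} (hE : FlatnessExtinction Λ θ κ) (hZ : ExactEndgame Λ) :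
    LinearisedFlatnessLayered Λ θ κ :=
  fun hP hL δ hδ S hS hO hflat => hZ δ hδ S hS.1 hS.2.1 (hE hP hL δ hδ S hS hO hflat)

/-- ★ **E ⟹ P♭** at every `Λ ≤ 4` (Z discharged by `exactEndgame_of_le`). -/
theorem linearisedFlatnessLayered_of_extinction {Λ θ κ : ℝ} (hΛ : Λ ≤ 4) (hE : FlatnessExtinction Λ θ κ) :
    LinearisedFlatnessLayered Λ θ κ :=
  linearisedFlatnessLayered_of_extinction_endgame hE (exactEndgame_of_le hΛ)

/-- ★★ **P♭ ⟸ H ALONE (modulo theorems)** — g24's declared residual shrinks to the ONE-STEP ε-regularity: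
`FlatnessHalving Λ θ κ → LinearisedFlatnessLayered Λ θ κ` for `Λ ≤ 4`, `0 < κ`. -/
theorem linearisedFlatnessLayered_of_halving {Λ θ κ : ℝ} (hΛ : Λ ≤ 4) (hκ : 0 < κ) (hH : FlatnessHalving Λ θ κ) :
    LinearisedFlatnessLayered Λ θ κ :=
  linearisedFlatnessLayered_of_extinction hΛ (flatnessExtinction_of_halving hκ hH)

/-- H is ANTI-monotone in θ and ANTI-monotone in κ (more levels to halve = a stronger statement): in particular H(·,·,1/16) ⟹ H(·,·,1/64). -/
theorem FlatnessHalving.anti_anti {Λ θ θ' κ κ' : ℝ} (hθ : θ ≤ θ') (hκ : κ ≤ κ') (h : FlatnessHalving Λ θ' κ') : FlatnessHalving Λ θ κ := by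
  intro hP hL δ hδ
  obtain ⟨M, hM, R₀, hR₀, hstep⟩ := h hP hL δ hδ
  exact ⟨M, hM, R₀, hR₀, fun S hS hO η hη hηκ R hR hW =>
    hstep S hS (fun q hq => (hO q hq).mono hθ) η hη (hηκ.trans hκ) R hR hW⟩

/-- E is ANTI-monotone in θ and ANTI-monotone in κ. -/
theorem FlatnessExtinction.anti_anti {Λ θ θ' κ κ' : ℝ} (hθ : θ ≤ θ') (hκ : κ ≤ κ') (h : FlatnessExtinction Λ θ' κ') :
    FlatnessExtinction Λ θ κ :=
  fun hP hL δ hδ S hS hO hflat => h hP hL δ hδ S hS (fun q hq => (hO q hq).mono hθ) (fun R hR => nearHomL2BD_mono hκ (hflat R hR))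

/-- the seam beneath N″(Λ, θ) in H-form: R ∧ L_lay ∧ H ⟹ N″(Λ, θ) (`Λ ≤ 4`, `0 < κ`). -/
theorem nonlinearTransferOsc_of_halving {Λ θ κ : ℝ} (hΛ : Λ ≤ 4) (hκ : 0 < κ) (hRig : OscRigidityL2BD Λ θ κ) (hC : LayeredLiouvilleCert)
    (hH : FlatnessHalving Λ θ κ) : NonlinearTransferOsc Λ θ :=
  nonlinearTransferOsc_of_L2_layered hRig hC (linearisedFlatnessLayered_of_halving hΛ hκ hH)

/-! ### the v9 columns: P♭ replaced by H -/

/-- ★★ **COLUMN OF RECORD (v9), certificate form — SIX leaves**: `LatticeLiouvilleCert → LayeredLiouvilleCert → R(2,1/16,1/16) → D(2,1/16,1/16,1/64) →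
H(2,1/16,1/64) → HBG″ → VisibleGap (1/50) ∧ PertRegime (1/50)` (P♭ ⟸ H, Z a theorem). -/
theorem gap_and_pert_1_50_of_certs_16h (hL : LatticeLiouvilleCert) (hL' : LayeredLiouvilleCert) (hR : OscRigidityL2BD 2 (1 / 16) (1 / 16))
    (hDec : OscFlatnessDecay 2 (1 / 16) (1 / 16) (1 / 64)) (hH : FlatnessHalving 2 (1 / 16) (1 / 64)) (hG : PeriodicBulkGapDoor 2) :
    VisibleGap (1 / 50) ∧ PertRegime (1 / 50) :=
  gap_and_pert_1_50_of_certs_16d hL hL' hR hDec (linearisedFlatnessLayered_of_halving (by norm_num) (by norm_num) hH) hG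

/-- ★★ **COLUMN OF RECORD (v9), resolved form — TEN leaves**: `LJDecay → LJMoments → CleanCrystalStability → LayeredDecay → LayeredMoments →
LayeredCrystalStability → R(2,1/16,1/16) → D(2,1/16,1/16,1/64) → H(2,1/16,1/64) → HBG″ → VisibleGap (1/50) ∧ PertRegime (1/50)`. -/
theorem gap_and_pert_1_50_of_layered_pieces_16h (hD : LJDecay) (hM : LJMoments) (hC : CleanCrystalStability)
    (hD' : LayeredDecay) (hM' : LayeredMoments) (hC' : LayeredCrystalStability)
    (hR : OscRigidityL2BD 2 (1 / 16) (1 / 16)) (hDec : OscFlatnessDecay 2 (1 / 16) (1 / 16) (1 / 64))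
    (hH : FlatnessHalving 2 (1 / 16) (1 / 64)) (hG : PeriodicBulkGapDoor 2) : VisibleGap (1 / 50) ∧ PertRegime (1 / 50) :=
  gap_and_pert_1_50_of_layered_pieces_16d hD hM hC hD' hM' hC' hR hDec (linearisedFlatnessLayered_of_halving (by norm_num) (by norm_num) hH) hG

/-- ★ **OPTIMISTIC `_16H`** (halving from the RIGIDITY level down; D ∧ P♭ both absorbed since H(·,·,1/16) ⟹ H(·,·,1/64) and E ⟸ H needs no D):
`LatticeLiouvilleCert → LayeredLiouvilleCert → R(2,1/16,1/16) → H(2,1/16,1/16) → HBG″ → VisibleGap (1/50) ∧ PertRegime (1/50)` — FOUR Liouville-side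
leaves; of record only if census TAG 163 (b) shows one-step contraction from rms environment misfit `1/4`. -/
theorem gap_and_pert_1_50_of_certs_16H (hL : LatticeLiouvilleCert) (hL' : LayeredLiouvilleCert) (hR : OscRigidityL2BD 2 (1 / 16) (1 / 16))
    (hH : FlatnessHalving 2 (1 / 16) (1 / 16)) (hG : PeriodicBulkGapDoor 2) : VisibleGap (1 / 50) ∧ PertRegime (1 / 50) :=
  gap_and_pert_1_50_of_certs_16r hL hL' hR (linearisedFlatnessLayered_of_halving (by norm_num) (by norm_num) hH) hG

end Summit.AtomisticToContinuum.Crystallization.Theorems.ChartedZeroExcessLayeredLatticeLiouville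

end
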